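import Literature.Computability.QuantumComplexity.SandwichBlock
import Literature.Computability.QuantumComplexity.SandwichCircuit
import Literature.Computability.QuantumComplexity.SandwichApprox
import Literature.Computability.QuantumComplexity.ReflectionGadget
import Literature.Computability.QuantumComplexity.OAAWord
import HarnessLib

/-!
# The Hadamard-sandwich + OAA gadget, assembled: a Clifford+T word implementing a controlled rotation

Topic `Literature/Computability/QuantumComplexity`; a step in the discharge of
`ajl_jonesApproxProblem_mem_PromiseBQP`. Everything proved so far about the gadget is put together:
given

* the geometry (target wire `t`, column ancilla `c`, averaging wires `as`, a control wire `f`, a list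
  `region` of further ancilla wires the flag program may use, reflection helpers `hs`),
* a classical reversible program `ops` and a flag wire `Fz` whose value on the labels summed over
  is a Boolean function `σ bb zt zf n` of the column bit, the input target bit, the control bit and
  the number `n` on the averaging wires (`hflag`; supplied by `SLP.BExpr.clEval_compile` for
  threshold predicates),
* unitary one-qubit blocks `U zf` and the **entry bound** `hent`: the averages
  `1 − 2·#{n < 2^k | σ bb zt zf n}/2^k` are within `η` of the entries of `−U zf`,

the Clifford+T word `oaaWordCircuit (sandwichCircuit (c :: as) c t ops [] [Fz]) (reflectCircuit c (as ++ region) hs)`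
implements, on inputs clean on `c :: as ++ region` and on `hs`, the label-controlled gate
`ctrlGate t (fun z => U (z f))` up to `9 √(2η)` in operator norm (`rotGadget_implOn`). (The sign:
the word is `−oaaOp`, so one block-encodes `−U/2`.)

## References

* D. W. Berry, A. M. Childs, R. Cleve, R. Kothari, R. D. Somma, STOC 2014, Lemma 3.1 and proof of
  Thm. 1.1 [BerryEtAl2014].
* D. Aharonov, V. Jones, Z. Landau, Algorithmica 55 (2009), Claim 4.1 and Thm. 4.3 (approximating
  each gate to `1/poly` in operator norm suffices) [AharonovJonesLandau2009].
-/

noncomputable section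

namespace Literature.Computability.QuantumComplexity

open _root_.Matrix Finset Cryptography
open scoped Matrix.Norms.L2Operator

variable {N : ℕ}

/-- Negating the blocks negates `ctrlGate`. [folklore] -/
theorem ctrlGate_neg (t : Fin N) (U : QReg N → Matrix (QReg 1) (QReg 1) ℂ) :
    ctrlGate t (fun z => -U z) = -ctrlGate t U := by
  ext x z; simp only [ctrlGate_apply, Matrix.neg_apply]; split_ifs <;> simp

/-- Membership in `cleanOn ws` does not depend on a wire outside `ws`. [folklore] -/
theorem update_mem_cleanOn_iff {ws : List (Fin N)} {t : Fin N} (ht : t ∉ ws) (x : QReg N) (b : Bool) :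
    Function.update x t b ∈ cleanOn ws ↔ x ∈ cleanOn ws := by
  simp only [mem_cleanOn]
  exact forall₂_congr fun a ha => by rw [Function.update_of_ne (show a ≠ t from fun e => ht (e ▸ ha))]

/-- **The assembled gadget.** See the module docstring. [cite: BerryEtAl2014, Lemma 3.1 and proof of Thm. 1.1]
[cite: AharonovJonesLandau2009, Claim 4.1] -/
theorem rotGadget_implOn {c t f Fz : Fin N} {as region hs : List (Fin N)} (ops : List (ClOp (Fin N)))
    (hwf : ∀ op ∈ ops, op.WF)
    (hnd : (c :: as).Nodup) (ht : t ∉ c :: as) (hct : c ≠ t) (htr : t ∉ region) (hft : f ≠ t)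
    (hlen : (as ++ region).length = hs.length) (hne : hs ≠ []) (hsnd : hs.Nodup) (hchs : c ∉ hs)
    (hls : ∀ l ∈ as ++ region, l ∉ hs ∧ l ≠ c) (hlsnd : (c :: (as ++ region)).Nodup)
    (hwfR : ∀ op ∈ reflectProg c (as ++ region) hs, op.WF)
    (hsw : ∀ h ∈ hs, h ∉ sandwichWires (c :: as) c t ops [] [Fz])
    (σ : Bool → Bool → Bool → ℕ → Bool)
    (hflag : ∀ z, z ∈ cleanOn (c :: as ++ region) → ∀ (bb : Bool) (n : ℕ), n < 2 ^ as.length →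
      clEval ops (writeNat as (Function.update z c bb) n) Fz = σ bb (z t) (z f) n)
    (U : Bool → Matrix (QReg 1) (QReg 1) ℂ) (hU : ∀ b, U b ∈ Matrix.unitaryGroup (QReg 1) ℂ) {η : ℝ} (hη : 0 ≤ η)
    (hent : ∀ bb zt zf : Bool,
      ‖((1 : ℂ) - 2 * (((Finset.range (2 ^ as.length)).filter fun n => σ bb zt zf n = true).card : ℂ) / 2 ^ as.length) -
        (-(U zf) (fun _ => bb ^^ zt) (fun _ => zt))‖ ≤ η) :
    ImplOn (cleanOn (c :: as ++ region) ∩ cleanOn hs)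
      ((oaaWordCircuit (sandwichCircuit (c :: as) c t hct ops hwf [] [Fz]) (reflectCircuit c (as ++ region) hs hne hwfR)).toMatrix 0)
      (ctrlGate t (fun z => U (z f))) (9 * Real.sqrt (2 * η)) := by
  set P : Set (QReg N) := cleanOn (c :: as ++ region) with hPdef
  set GW := sandwichCircuit (c :: as) c t hct ops hwf [] [Fz] with hGW
  set GR := reflectCircuit c (as ++ region) hs hne hwfR with hGR
  set W := GW.toMatrix 0 with hW
  -- (a) the reflection acts as `1 − 2Π` on helper-clean states
  have hR : ∀ ψ, SuppIn (cleanOn hs) ψ → GR.toMatrix 0 *ᵥ ψ = (1 - (2 : ℂ) • projOn P) *ᵥ ψ := by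
    intro ψ hψ
    have := reflectCircuit_mulVec_eq 0 hlen hne hsnd hchs hls hlsnd hwfR ψ hψ
    rw [hGR, this, hPdef]; rfl
  -- (b) `W` and `W.inv` preserve helper-cleanliness
  have hoff : ∀ g ∈ GW.gates, ∀ a ∈ hs, a ∉ g.wires := fun g hg a ha hx =>
    hsw a ha (mem_sandwichWires_of_mem_gates (c :: as) c t hct ops hwf [] [Fz] hg hx)
  have hWS : PreservesSupp (cleanOn hs) (GW.toMatrix 0) := preservesSupp_toMatrix_of_offWires 0 GW.gates hoff
  have hWS' : PreservesSupp (cleanOn hs) (GW.inv.toMatrix 0) := preservesSupp_inv_toMatrix_of_offWires 0 GW hoff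
  -- (c) OAA on the block encoding
  have htP : t ∉ c :: as ++ region := by
    simp only [List.cons_append, List.mem_cons, List.mem_append, not_or] at ht ⊢
    exact ⟨ht.1, ht.2, htr⟩
  have hP : ∀ x b, Function.update x t b ∈ P ↔ x ∈ P := fun x b => update_mem_cleanOn_iff htP x b
  have hWu : W ∈ Matrix.unitaryGroup (QReg N) ℂ := QCircuit.toMatrix_mem_unitaryGroup_holds cliffordT_isUnitary_holds 0 GW
  have hWmat : W = hadLayerRev (c :: as) * ((cnotOn c t hct).toMatrix 0 * phaseDiag (phaseKickExp ops [] [Fz])) * hadLayer (c :: as) := by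
    rw [hW, hGW, sandwichCircuit_toMatrix]
  have hclean : ∀ {x : QReg N}, x ∈ P → ∀ i ∈ c :: as, x i = false := fun hx i hi =>
    hx i (by simp only [List.cons_append, List.mem_cons, List.mem_append] at hi ⊢; tauto)
  -- the exponent on the summed labels
  have hg : ∀ {x z : QReg N}, z ∈ P → ∀ n, n < 2 ^ as.length →
      phaseKickExp ops [] [Fz] (writeNat as (Function.update z c (x t ^^ z t)) n) = 2 * (σ (x t ^^ z t) (z t) (z f) n).toNat := by
    intro x z hz n hn
    rw [phaseKickExp, countOn, countOn, List.countP_nil, zero_add, List.countP_cons, List.countP_nil, zero_add,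
      hflag z hz _ n hn]
    cases σ (x t ^^ z t) (z t) (z f) n <;> simp
  have hWloc : ∀ x z, x ∈ P → z ∈ P → ¬ EqOff [t] z x → W x z = 0 := by
    intro x z hx hz hzx
    have e := two_mul_sandwich_entry_of_sign hnd ht hct (phaseKickExp ops [] [Fz]) (hclean hx) (hclean hz) _ (hg hz)
    rw [← hWmat] at e
    rw [if_neg] at e
    · simpa using e
    · intro hE; apply hzx
      intro j hj
      rw [List.mem_singleton] at hj
      by_cases hj' : j ∈ c :: as
      · rw [hclean hz j hj', hclean hx j hj']
      · exact hE j (by simp only [List.mem_cons, not_or] at hj' ⊢; exact ⟨hj, hj'.1, hj'.2⟩)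
  have hWent : ∀ x z, x ∈ P → z ∈ P → EqOff [t] z x →
      ‖2 * W x z - (fun z => -U (z f)) z (fun _ => x t) (fun _ => z t)‖ ≤ η := by
    intro x z hx hz hzx
    have e := two_mul_sandwich_entry_of_sign hnd ht hct (phaseKickExp ops [] [Fz]) (hclean hx) (hclean hz) _ (hg hz)
    rw [← hWmat] at e
    have hE : EqOff (t :: c :: as) z x := by
      intro j hj
      simp only [List.mem_cons, not_or] at hj
      by_cases hjt : j = t
      · exact absurd hjt hj.1
      · exact hzx j (by simp [hjt])
    rw [if_pos hE] at e
    rw [e]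
    have hxt : x t = ((x t ^^ z t) ^^ z t) := by cases x t <;> cases z t <;> rfl
    have := hent (x t ^^ z t) (z t) (z f)
    rw [← hxt] at this
    exact this
  have hUneg : ∀ z : QReg N, (fun z => -U (z f)) z ∈ Matrix.unitaryGroup (QReg 1) ℂ := fun z => by
    have h1 := Matrix.mem_unitaryGroup_iff.1 (hU (z f))
    exact Matrix.mem_unitaryGroup_iff.2 (by rw [star_neg, neg_mul_neg]; exact h1)
  have hUt : ∀ (z : QReg N) (b : Bool), (fun z => -U (z f)) (Function.update z t b) = (fun z => -U (z f)) z := fun z b => by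
    simp only [Function.update_of_ne hft]
  have hOAA := implOn_oaaOp_of_entries (t := t) (U := fun z => -U (z f)) hP hWu hUneg hUt hη hWloc hWent
  have hfin := implOn_oaaWordCircuit GW GR P (cleanOn hs) hR hWS hWS' hOAA
  rw [← ctrlGate_neg] at hfin
  simpa only [neg_neg] using hfin

end Literature.Computability.QuantumComplexity

end
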